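import Literature.NumberTheory.EllipticCurves.TwoVariableSelmerDual
import Literature.NumberTheory.IwasawaTheory.IwasawaAlgebraTwoVarRegularProofs
import HarnessLib

/-!
# Principality of two-variable characteristic ideals over `Λ₂ = ℤ_p⟦T₁⟧⟦T₂⟧` — stub P0 of the O2 line
# `two_variable_gv_squeeze_two` (crux `BDPSelmerLowerDivisibilityAtTwo`, stmt-BirchSwinnertonDyer-24728; route
# `TwoAdicConverse`, rung S3)

Helper file `--supports stmt-BirchSwinnertonDyer-24728` (seat `bsd-2adic-tower-1` GEN 44, pen RC-547 (B)(ii)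
«then P0 (L; UFD of `ℤ₂⟦T₁,T₂⟧`, Mathlib gap; one-variable model `charIdeal_isPrincipal_holds`)»). THEOREMS ONLY.

The «Mathlib gap» is CLOSED IN THE TREE: `Λ₂ = PowerSeries (PowerSeries ℤ_[p])` is a regular local ring of
dimension `3`, hence factorial by Auslander–Buchsbaum
(`Literature.NumberTheory.IwasawaTheory.uniqueFactorizationMonoid_iwasawaAlgebraTwoVar`, via
`Resolution.uniqueFactorizationMonoid_of_isRegularLocalRing`, Matsumura Thm. 20.3 — kernel theorems). Hence,
exactly as in the one-variable `charIdeal_isPrincipal_holds` (Washington §13.2): every height-one prime of `Λ₂`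
is principal (Mathlib `UniqueFactorizationMonoid.isPrincipal_of_height_eq_one`), so the tree's `Module.charIdeal`
(the `finprod` of powers of height-one primes) is principal for EVERY `Λ₂`-module — no torsion hypothesis needed.

* `charIdeal_isPrincipal_two_var` — `(Module.charIdeal (IwasawaAlgebra₂ p) M).IsPrincipal`, any `p`, any `M`.
* `exists_xGr₂_charIdeal_eq_span` — `∃ C, ch_{Λ_K}(X_Gr(E/K̃_∞)) = (C)`, any `p`, any curve / field / datum.
* `exists_xGr₂_charIdeal_eq_span_two` — stub P0 `TwoVariableGvSqueezeTwo.XGr₂CharIdealPrincipalAtTwo` in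
  UNFOLDED form, character for character (its `Module.IsTorsion` hypothesis is idle). Drop-in:
  `theorem stub_charIdealPrincipal : XGr₂CharIdealPrincipalAtTwo := fun W _ _ K _ _ vbar κ₁ κ₂ γ₁ γ₂ _ h =>
  …exists_xGr₂_charIdeal_eq_span_two W K vbar κ₁ κ₂ γ₁ γ₂ h`.

Nothing about any elliptic curve is asserted beyond pure algebra; O2 and its research stubs U, R stay OPEN;
BSD is proved for no curve. References: [Matsumura1987] Thm. 20.3; [Washington1997] §13.2.
-/

-- D-0017: single-problem summit, the namespace repeats the problem name by design.
set_option linter.dupNamespace false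
set_option autoImplicit false

noncomputable section

open scoped Classical

namespace Summit.BirchSwinnertonDyer.BirchSwinnertonDyer.Theorems.TwoAdicBDPCharIdealPrincipal

open NumberField IsDedekindDomain Literature.NumberTheory.EllipticCurves
  Literature.NumberTheory.EllipticCurves.Rubin1991 Literature.NumberTheory.IwasawaTheory

universe u

variable (p : ℕ) [Fact p.Prime]

/-- **Characteristic ideals over `Λ₂ = ℤ_p⟦T₁⟧⟦T₂⟧` are principal**: `Λ₂` is factorial (regular local of
dimension `3`, Auslander–Buchsbaum — tree theorem `uniqueFactorizationMonoid_iwasawaAlgebraTwoVar`), so its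
height-one primes are principal and so is the (finite, or junk `1`) product `Module.charIdeal Λ₂ M`.
[cite: Matsumura1987, Thm. 20.3 (PDF p. 179)] [cite: Washington1997, §13.2] -/
theorem charIdeal_isPrincipal_two_var (M : Type*) [AddCommGroup M] [Module (IwasawaAlgebra₂ p) M] :
    (Module.charIdeal (IwasawaAlgebra₂ p) M).IsPrincipal := by
  haveI : UniqueFactorizationMonoid (IwasawaAlgebra₂ p) := uniqueFactorizationMonoid_iwasawaAlgebraTwoVar p
  unfold Module.charIdeal
  rw [← Ideal.mem_isPrincipalSubmonoid_iff]
  refine finprod_mem_induction (· ∈ Ideal.isPrincipalSubmonoid (IwasawaAlgebra₂ p))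
    (Submonoid.one_mem _) (fun _ _ hx hy => Submonoid.mul_mem _ hx hy) ?_
  intro 𝔭 h𝔭
  refine Submonoid.pow_mem _ ?_ _
  obtain ⟨g, hg⟩ := UniqueFactorizationMonoid.isPrincipal_of_height_eq_one h𝔭
  rw [hg]
  exact Ideal.span_singleton_mem_isPrincipalSubmonoid g

variable {K : Type u} [Field K] [NumberField K]

/-- **`ch_{Λ_K}(X_Gr(E/K̃_∞))` is principal** for every prime `p`, every curve over a number field `K`, every
pair of `ℤ_p`-extensions with topological generators and every `v̄` — an instance of
`charIdeal_isPrincipal_two_var`. [cite: Matsumura1987, Thm. 20.3 (PDF p. 179)] -/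
theorem exists_xGr₂_charIdeal_eq_span (W : WeierstrassCurve K) (κ₁ κ₂ : ZpExtension K p)
    (vbar : HeightOneSpectrum (𝓞 K)) (γ₁ γ₂ : Field.absoluteGaloisGroup K)
    [Fact (ZpExtension.IsTopGeneratorPair κ₁ κ₂ γ₁ γ₂)] :
    ∃ C : IwasawaAlgebra₂ p, WeierstrassCurve.XGr₂.charIdeal W p κ₁ κ₂ vbar γ₁ γ₂ = Ideal.span {C} :=
  (charIdeal_isPrincipal_two_var p (W.XGr₂ p κ₁ κ₂ vbar γ₁ γ₂)).principal

/-- **Stub P0 of line `two_variable_gv_squeeze_two` (`TwoVariableGvSqueezeTwo.XGr₂CharIdealPrincipalAtTwo`),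
proved, in UNFOLDED form character for character** (the `Module.IsTorsion` hypothesis of the stub is idle:
principality holds for every `Λ₂`-module). [cite: Matsumura1987, Thm. 20.3 (PDF p. 179)] -/
theorem exists_xGr₂_charIdeal_eq_span_two (W : WeierstrassCurve ℚ) [W.IsElliptic] [W.IsGloballyMinimal]
    (K : Type) [Field K] [NumberField K] (vbar : HeightOneSpectrum (𝓞 K)) (κ₁ κ₂ : ZpExtension K 2)
    (γ₁ γ₂ : Field.absoluteGaloisGroup K) [Fact (ZpExtension.IsTopGeneratorPair κ₁ κ₂ γ₁ γ₂)]
    (_htor : Module.IsTorsion (IwasawaAlgebra₂ 2) ((W.baseChange K).XGr₂ 2 κ₁ κ₂ vbar γ₁ γ₂)) :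
    ∃ C : IwasawaAlgebra₂ 2,
      WeierstrassCurve.XGr₂.charIdeal (W.baseChange K) 2 κ₁ κ₂ vbar γ₁ γ₂ = Ideal.span {C} :=
  exists_xGr₂_charIdeal_eq_span 2 (W.baseChange K) κ₁ κ₂ vbar γ₁ γ₂

end Summit.BirchSwinnertonDyer.BirchSwinnertonDyer.Theorems.TwoAdicBDPCharIdealPrincipal

end
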